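import Summits.QuantumFields.BalabanUV.T4Continuum.Support.NE7DivergenceOrthogonalAvgKernel
import Summits.QuantumFields.BalabanUV.T4Continuum.Support.NE7LandauCorrection
import Summits.QuantumFields.BalabanUV.T4Continuum.Support.NE7SoftOperatorGaugePositivity

/-!
# NE7MinNormGaugeRepresentative — THE MINIMAL-NORM SECTION OF THE `N(Q′(W))`-ORBITS AND ITS COMPARISON WITH PRINT's MINIMAL-DIVERGENCE SECTION `T_A`:
# every skew torus 1-form `t` has `λ ∈ N(Q′(W))` with `t_L := t − D_Wλ ⊥ D_W N(Q′(W))`; if `t` is in the [B8] (1.38) gauge `R D_W† t = 0` then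
# `‖t‖² ≤ (1 + 4·C_div²)·‖t_L‖²` (NO power of `M` lost), and `‖t_L‖ ≤ ‖t_L + D_Wκ‖` for every `κ ∈ N(Q′(W))` (file 151 of the curved (APE), F222)

Cell `pub-balaban`, rung (B)+1 sub-cell t4, lineage `b2b-balaban-t4-ne7-p1` (CRUX PROVER NE7 #1 = OWNER of row NE7), generation 86; memo
`t4/b2b-balaban-t4-ne7-p1-g86/ORBIT-COMPARISON.md` §3.  Over F221 `NE7DivergenceOrthogonalAvgKernel.norm_sq_adjoint_gradOpK_le_of_orthogonal` ((DIV): `b ⊥ D_W N ⟹ ‖D_W†b‖² ≤ (C_div²∕M²)‖b‖²`),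
F210 `NE7SoftOperatorGaugePositivity.sum_nhsNormSq_gaugeDir_le_covLap` (gauge Poincaré `‖D_Wλ‖² ≤ 4M²‖Δ_Wλ‖²` on `N(Q′(W))`), F209 `adjoint_gradOpK_gaugeDir` (`D_W†D_Wλ = Δ_Wλ ∈ landauTestsK`),
F217's closure lemmas of `avgKernelGauges`, and Mathlib's orthogonal projection BY NAME.
WHY.  [B9] (3.22): `R(W)` projects onto `Δ_W N(Q′(W))`, so `R D_W† t = 0` says `D_W† t ⊥ Δ_W N` — `t` MINIMISES `‖D_W†(t + D_Wμ)‖` over `μ ∈ N` (print's section `T_A`), whereas the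
section on which row NE3's slice theorem transfers for free is the one minimising `‖t + D_Wμ‖` (`t_L ⊥ D_W N`).  The two differ by `D_Wλ` with `Δ_Wλ = R D_W† t_L`, and
`‖D_Wλ‖ ≤ 2M‖Δ_Wλ‖ ≤ 2M‖D_W† t_L‖ ≤ 2M·(C_div∕M)‖t_L‖ = 2C_div‖t_L‖` — the gauge Poincaré LOSES `M`, the rigidity (DIV) GAINS it back.  (Flat numerics, gen 86 kit j307726: the
Poincaré constants of `T_A` and of the min-norm section coincide, `≈ 0.10·M²`, d = 2, 3, M ≤ 16.)
WHAT ([folklore]; 0 def, 0 sorry).  §1 **`exists_minNorm_gauge`** (the orthogonal projection onto `span{D_W resS μ : μ ∈ N}` is a `D_W resS λ`, `λ ∈ N`); §2 `core_sq_le`,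
**`norm_sq_le_of_landau_minNorm`** (the title); §3 **`norm_sq_minNorm_le`** (`‖t_L‖² ≤ ‖t_L + D_Wκ‖²`).
HONEST FRAMING (page 1): finite-dimensional linear algebra over landed estimates at one background of the class; nothing of Bałaban's asserted; (H1), (P_a), (KL-B), (APE) on curved data NOT
proved here; NOT ONE-STEP, NOT NE7; spine 0∕9; finite T⁴ rung (B)+1 — NOT infinite volume, NOT mass gap, NOT `BetaPertH`, NOT Clay.  Continuum YM on T⁴ ⇐ BetaPertH ∧ nine spine
estimates (0/9 proved); BetaPertH ⇐ (D1) ∧ (D4) ∧ CAP+tail; G-an2-4 gates asym, D1 and NE2/3/4.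
-/

set_option autoImplicit false

open scoped BigOperators InnerProductSpace Matrix Matrix.Norms.L2Operator
open Finset

namespace Summit.QuantumFields.BalabanUV.T4Continuum.NE7MinNormGaugeRepresentative

open Literature.MathematicalPhysics.QuantumFieldTheory.Balaban1983to89
open B7Prop1Explicit B7Prop2Explicit UnitaryModel MatrixNorms
open T4AveragingDeficitWall (IsUnitaryCfg IsSkewDir SmallField)
open T4AveragingDeficitWallBoundary (periodBox IsPeriodicCfg)
open AveragingDeficitPeriodicCounting (IsPeriodicDir)
open AveragingDeficitMultiLevelPrep (LevelSmall)
open AveragingDeficitTwoLevelPrep (prop1Radius)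
open SpreadLift (loopRad)
open BlockAveragePushDirGauge (gaugeDir isPeriodicDir_gaugeDir)
open NE3HilbertSchmidtTorus
open NE3.PairLandauB8 (avgKernelGauges covLapSite mem_avgKernelGauges_iff)
open NE7BalabanSoftOperator
open NE7BalabanSoftOperatorMass
open NE7GaugeFixOnPureGauges (resS_mem_of_avgKernel coe_gradOpK_resS adjoint_gradOpK_gaugeDir)
open NE7SoftOperatorGaugePositivity (sum_nhsNormSq_gaugeDir_le_covLap)
open NE7LandauCorrection (zero_mem_avgKernelGauges add_mem_avgKernelGauges smul_mem_avgKernelGauges)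
open NE7DivergenceOrthogonalAvgKernel (norm_sq_adjoint_gradOpK_le_of_orthogonal)
open NE7SquaredBumpNestedMeanOperator (tentMean2)

noncomputable section

variable {d : ℕ} {n : Type*} [Fintype n] [DecidableEq n]

section Carrier

variable [Nonempty n] {L N : ℕ} [NeZero N] (hL2 : 2 ≤ L) (j : ℕ) [NeZero (N * L ^ (j + 1))]
  {W : Site d → Fin d → (Matrix n n ℂ)ˣ} {x : ℝ} (hWu : IsUnitaryCfg W) (hWP : IsPeriodicCfg W ((N * L ^ (j + 1) : ℕ) : ℤ))
  (hx : 0 ≤ x) (hs : LevelSmall d L j x) (hWx : SmallField W x)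

/-! ## §1 The orthogonal projection onto the gauge orbit `D_W N(Q′(W))` -/

omit [Nonempty n] [NeZero N] in
/-- `D_W resS` of a sum in `N(Q′(W))`. [folklore] -/
theorem gradOpK_resS_add {μ ν : Site d → Matrix n n ℂ} (hμ : μ ∈ avgKernelGauges (d := d) (n := n) L N (j + 1) W)
    (hν : ν ∈ avgKernelGauges (d := d) (n := n) L N (j + 1) W) :
    gradOpK hWu (N * L ^ (j + 1)) ⟨resS (N * L ^ (j + 1)) (μ + ν), resS_mem_of_avgKernel (add_mem_avgKernelGauges hμ hν)⟩
      = gradOpK hWu (N * L ^ (j + 1)) ⟨resS (N * L ^ (j + 1)) μ, resS_mem_of_avgKernel hμ⟩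
        + gradOpK hWu (N * L ^ (j + 1)) ⟨resS (N * L ^ (j + 1)) ν, resS_mem_of_avgKernel hν⟩ := by
  rw [← map_add]; congr 1

omit [Nonempty n] [NeZero N] in
/-- `D_W resS` of a real multiple in `N(Q′(W))`. [folklore] -/
theorem gradOpK_resS_smul (c : ℝ) {μ : Site d → Matrix n n ℂ} (hμ : μ ∈ avgKernelGauges (d := d) (n := n) L N (j + 1) W) :
    gradOpK hWu (N * L ^ (j + 1)) ⟨resS (N * L ^ (j + 1)) (c • μ), resS_mem_of_avgKernel (smul_mem_avgKernelGauges c hμ)⟩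
      = c • gradOpK hWu (N * L ^ (j + 1)) ⟨resS (N * L ^ (j + 1)) μ, resS_mem_of_avgKernel hμ⟩ := by
  rw [← map_smul]; congr 1

omit [Nonempty n] [NeZero N] in
/-- `D_W resS 0 = 0`. [folklore] -/
theorem gradOpK_resS_zero :
    gradOpK hWu (N * L ^ (j + 1)) ⟨resS (N * L ^ (j + 1)) (0 : Site d → Matrix n n ℂ), resS_mem_of_avgKernel (zero_mem_avgKernelGauges L N (j + 1) W)⟩ = 0 := by
  have h0 : (⟨resS (N * L ^ (j + 1)) (0 : Site d → Matrix n n ℂ), resS_mem_of_avgKernel (zero_mem_avgKernelGauges L N (j + 1) W)⟩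
      : skewSecs d n (N * L ^ (j + 1))) = 0 := by
    apply Subtype.ext; ext s : 1; rfl
  rw [h0, map_zero]

omit [Nonempty n] [NeZero N] in
/-- **THE MINIMAL-NORM GAUGE**: every skew torus 1-form `b` has `λ ∈ N(Q′(W))` with `b − D_W λ ⊥ D_W μ` for all `μ ∈ N(Q′(W))` (orthogonal projection onto the span of the orbit
directions; the span is the image of the linear space `N(Q′(W))`). [folklore] -/
theorem exists_minNorm_gauge (b : skewForms d n (N * L ^ (j + 1))) :
    ∃ lam : Site d → Matrix n n ℂ, ∃ hlam : lam ∈ avgKernelGauges (d := d) (n := n) L N (j + 1) W,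
      ∀ (μ : Site d → Matrix n n ℂ) (hμ : μ ∈ avgKernelGauges (d := d) (n := n) L N (j + 1) W),
        ⟪b - gradOpK hWu (N * L ^ (j + 1)) ⟨resS (N * L ^ (j + 1)) lam, resS_mem_of_avgKernel hlam⟩,
          gradOpK hWu (N * L ^ (j + 1)) ⟨resS (N * L ^ (j + 1)) μ, resS_mem_of_avgKernel hμ⟩⟫_ℝ = 0 := by
  set S : Submodule ℝ (skewForms d n (N * L ^ (j + 1))) := Submodule.span ℝ
    {v | ∃ (μ : Site d → Matrix n n ℂ) (hμ : μ ∈ avgKernelGauges (d := d) (n := n) L N (j + 1) W),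
      v = gradOpK hWu (N * L ^ (j + 1)) ⟨resS (N * L ^ (j + 1)) μ, resS_mem_of_avgKernel hμ⟩} with hS
  haveI : CompleteSpace S := FiniteDimensional.complete ℝ _
  have hmem : S.starProjection b ∈ S := Submodule.starProjection_apply_mem _ _
  -- the projection is an orbit direction
  have hrepr : ∀ v ∈ S, ∃ (lam : Site d → Matrix n n ℂ) (hlam : lam ∈ avgKernelGauges (d := d) (n := n) L N (j + 1) W),
      v = gradOpK hWu (N * L ^ (j + 1)) ⟨resS (N * L ^ (j + 1)) lam, resS_mem_of_avgKernel hlam⟩ := by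
    intro v hv
    induction hv using Submodule.span_induction with
    | mem v hv => exact hv
    | zero => exact ⟨0, zero_mem_avgKernelGauges L N (j + 1) W, (gradOpK_resS_zero j hWu).symm⟩
    | add v w _ _ ihv ihw =>
        obtain ⟨μ, hμ, rfl⟩ := ihv
        obtain ⟨ν, hν, rfl⟩ := ihw
        exact ⟨μ + ν, add_mem_avgKernelGauges hμ hν, (gradOpK_resS_add j hWu hμ hν).symm⟩
    | smul c v _ ih =>
        obtain ⟨μ, hμ, rfl⟩ := ih
        exact ⟨c • μ, smul_mem_avgKernelGauges c hμ, (gradOpK_resS_smul j hWu c hμ).symm⟩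
  obtain ⟨lam, hlam, heq⟩ := hrepr _ hmem
  refine ⟨lam, hlam, fun μ hμ => ?_⟩
  have hv : gradOpK hWu (N * L ^ (j + 1)) ⟨resS (N * L ^ (j + 1)) μ, resS_mem_of_avgKernel hμ⟩ ∈ S := Submodule.subset_span ⟨μ, hμ, rfl⟩
  rw [← heq]
  exact Submodule.inner_left_of_mem_orthogonal hv (Submodule.sub_starProjection_mem_orthogonal b)

/-! ## §2 `T_A` against the minimal-norm section -/

omit [Fintype n] [DecidableEq n] [Nonempty n] [NeZero N] [NeZero (N * L ^ (j + 1))] in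
/-- `a² ≤ b·a` ⇒ `a² ≤ b²`. [folklore] -/
theorem core_sq_le {a b : ℝ} (h : a ^ 2 ≤ b * a) : a ^ 2 ≤ b ^ 2 := by
  nlinarith [sq_nonneg (a - b)]

include hL2 hWP hx hs hWx in
/-- **`T_A` VS THE MINIMAL-NORM SECTION — NO POWER OF `M` LOST.**  In the class (`L ≥ 2`, unitary `(N·L^{j+1})`-periodic `W`, `LevelSmall d L j x`, `SmallField W x`, row NE3's gauge
Poincaré regime `hsmall`): if `λ ∈ N(Q′(W))`, `t_L = t − D_Wλ ⊥ D_W N(Q′(W))` and `R D_W† t = 0`, then `‖t‖² ≤ (1 + 4·C_div²)·‖t_L‖²`,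
`C_div² = card n·d·(2 + 2(d−1)(M−1)·M·x)²·(2∕tentMean2)²`. [folklore] -/
theorem norm_sq_le_of_landau_minNorm
    (hsmall : 8 * d * (((L : ℝ) ^ (j + 1)) * (((d : ℝ) - 1) * (((L : ℝ) ^ (j + 1)) - 1) * x)) ^ 2
      + 2 * (Fintype.card n * (4 * (d : ℝ) ^ 2 * ((L : ℝ) ^ (j + 1) - 1) ^ 2 * x + 16 * d * loopRad d L ((prop1Radius d L)^[j] x)) ^ 2) ≤ 1 / 2)
    (t tL : skewForms d n (N * L ^ (j + 1))) {lam : Site d → Matrix n n ℂ} (hlam : lam ∈ avgKernelGauges (d := d) (n := n) L N (j + 1) W)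
    (htL : tL = t - gradOpK hWu (N * L ^ (j + 1)) ⟨resS (N * L ^ (j + 1)) lam, resS_mem_of_avgKernel hlam⟩)
    (horth : ∀ (μ : Site d → Matrix n n ℂ) (hμ : μ ∈ avgKernelGauges (d := d) (n := n) L N (j + 1) W),
      ⟪tL, gradOpK hWu (N * L ^ (j + 1)) ⟨resS (N * L ^ (j + 1)) μ, resS_mem_of_avgKernel hμ⟩⟫_ℝ = 0)
    (hLandau : landauProjK L N (j + 1) W
      ((LinearMap.adjoint (𝕜 := ℝ) (E := skewSecs d n (N * L ^ (j + 1))) (F := skewForms d n (N * L ^ (j + 1))) (gradOpK hWu (N * L ^ (j + 1)))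
        : skewForms d n (N * L ^ (j + 1)) →ₗ[ℝ] skewSecs d n (N * L ^ (j + 1))) t) = 0) :
    ‖t‖ ^ 2 ≤ (1 + 4 * ((Fintype.card n : ℝ) * d * (2 + 2 * (((d : ℝ) - 1) * (((L : ℝ) ^ (j + 1)) - 1) * x) * (L : ℝ) ^ (j + 1)) ^ 2
            * (2 / tentMean2 d (L ^ (j + 1))) ^ 2)) * ‖tL‖ ^ 2 := by
  have hL1 : 1 ≤ L := by omega
  have hP : 1 ≤ N * L ^ (j + 1) := Nat.one_le_iff_ne_zero.mpr (NeZero.ne _)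
  have hM0 : (0 : ℝ) < (L : ℝ) ^ (j + 1) := by positivity
  obtain ⟨-, hlamP, -⟩ := mem_avgKernelGauges_iff.mp hlam
  set Gt := (LinearMap.adjoint (𝕜 := ℝ) (E := skewSecs d n (N * L ^ (j + 1))) (F := skewForms d n (N * L ^ (j + 1))) (gradOpK hWu (N * L ^ (j + 1)))
    : skewForms d n (N * L ^ (j + 1)) →ₗ[ℝ] skewSecs d n (N * L ^ (j + 1))) with hGt
  set g := gradOpK hWu (N * L ^ (j + 1)) ⟨resS (N * L ^ (j + 1)) lam, resS_mem_of_avgKernel hlam⟩ with hg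
  -- (1) Pythagoras
  have ht : t = tL + g := by rw [htL, sub_add_cancel]
  have hpyth : ‖t‖ ^ 2 = ‖tL‖ ^ 2 + ‖g‖ ^ 2 := by
    rw [ht, norm_add_sq_real, hg, horth _ hlam]; ring
  -- (3) gauge Poincaré on the carrier: `‖g‖² ≤ 4M²·‖G†g‖²`
  have hng : ‖g‖ ^ 2 = ∑ y ∈ periodBox (d := d) (N * L ^ (j + 1)), ∑ κ : Fin d, nhsNormSq (gaugeDir W lam y κ) := by
    rw [← norm_sq_resF (N * L ^ (j + 1)) (gaugeDir W lam), ← coe_gradOpK_resS hWu hlam, hg]; rfl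
  have hGtg : (Gt g : Sec d n (N * L ^ (j + 1))) = resS (N * L ^ (j + 1)) (covLapSite W lam) := by
    rw [hGt, hg]; exact adjoint_gradOpK_gaugeDir hWu hP hWP hlam
  have hnGtg : ‖Gt g‖ ^ 2 = ∑ y ∈ periodBox (d := d) (N * L ^ (j + 1)), nhsNormSq (covLapSite W lam y) := by
    rw [← norm_sq_resS (N * L ^ (j + 1)) (covLapSite W lam), ← hGtg]; rfl
  have hgp : ‖g‖ ^ 2 ≤ 4 * ((L : ℝ) ^ (j + 1)) ^ 2 * ‖Gt g‖ ^ 2 := by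
    rw [hng, hnGtg]; exact sum_nhsNormSq_gaugeDir_le_covLap (N := N) hL2 j hWu hWP hx hs hWx hsmall hlam
  -- (2) `‖G†g‖ ≤ ‖G† tL‖`: `G†g ∈ landauTestsK`, `G†t ⊥ landauTestsK`
  have hmemK : Gt g ∈ landauTestsK (d := d) (n := n) L N (j + 1) W := Submodule.subset_span ⟨lam, hlam, hGtg⟩
  have hperp : Gt t ∈ (landauTestsK (d := d) (n := n) L N (j + 1) W)ᗮ := (landauProjK_apply_eq_zero_iff L N (j + 1) W _).mp hLandau
  have hzero : ⟪Gt t, Gt g⟫_ℝ = 0 := Submodule.inner_left_of_mem_orthogonal hmemK hperp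
  have hdiv : ‖Gt g‖ ^ 2 ≤ ‖Gt tL‖ ^ 2 := by
    have e : ‖Gt g‖ ^ 2 = -⟪Gt tL, Gt g⟫_ℝ := by
      rw [← real_inner_self_eq_norm_sq]
      have hgsub : g = t - tL := by rw [ht, add_sub_cancel_left]
      calc ⟪Gt g, Gt g⟫_ℝ = ⟪Gt t - Gt tL, Gt g⟫_ℝ := by rw [← map_sub, ← hgsub]
        _ = ⟪Gt t, Gt g⟫_ℝ - ⟪Gt tL, Gt g⟫_ℝ := inner_sub_left _ _ _
        _ = -⟪Gt tL, Gt g⟫_ℝ := by rw [hzero, zero_sub]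
    have h1 : ‖Gt g‖ ^ 2 ≤ ‖Gt tL‖ * ‖Gt g‖ := by
      rw [e, ← inner_neg_left]
      exact (real_inner_le_norm _ _).trans (by rw [norm_neg])
    exact core_sq_le h1
  -- (4) (DIV)
  have hDIV := norm_sq_adjoint_gradOpK_le_of_orthogonal (N := N) hL2 j hWu hWP hx hs hWx tL horth
  rw [← hGt] at hDIV
  -- assemble
  set C2 : ℝ := (Fintype.card n : ℝ) * d * (2 + 2 * (((d : ℝ) - 1) * (((L : ℝ) ^ (j + 1)) - 1) * x) * (L : ℝ) ^ (j + 1)) ^ 2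
      * (2 / tentMean2 d (L ^ (j + 1))) ^ 2 with hC2
  have hkey : ‖g‖ ^ 2 ≤ 4 * C2 * ‖tL‖ ^ 2 := by
    calc ‖g‖ ^ 2 ≤ 4 * ((L : ℝ) ^ (j + 1)) ^ 2 * ‖Gt g‖ ^ 2 := hgp
      _ ≤ 4 * ((L : ℝ) ^ (j + 1)) ^ 2 * ‖Gt tL‖ ^ 2 := mul_le_mul_of_nonneg_left hdiv (by positivity)
      _ ≤ 4 * ((L : ℝ) ^ (j + 1)) ^ 2 * (C2 / ((L : ℝ) ^ (j + 1)) ^ 2 * ‖tL‖ ^ 2) := mul_le_mul_of_nonneg_left hDIV (by positivity)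
      _ = 4 * C2 * ‖tL‖ ^ 2 := by field_simp
  rw [hpyth]; linarith

/-! ## §3 The minimal-norm section minimises the norm in its orbit -/

omit [Nonempty n] [NeZero N] in
/-- **MIN-NORM**: if `t_L ⊥ D_W N(Q′(W))` then `‖t_L‖² ≤ ‖t_L + D_Wκ‖²` for every `κ ∈ N(Q′(W))`. [folklore] -/
theorem norm_sq_minNorm_le (tL : skewForms d n (N * L ^ (j + 1)))
    (horth : ∀ (μ : Site d → Matrix n n ℂ) (hμ : μ ∈ avgKernelGauges (d := d) (n := n) L N (j + 1) W),
      ⟪tL, gradOpK hWu (N * L ^ (j + 1)) ⟨resS (N * L ^ (j + 1)) μ, resS_mem_of_avgKernel hμ⟩⟫_ℝ = 0)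
    {κ : Site d → Matrix n n ℂ} (hκ : κ ∈ avgKernelGauges (d := d) (n := n) L N (j + 1) W) :
    ‖tL‖ ^ 2 ≤ ‖tL + gradOpK hWu (N * L ^ (j + 1)) ⟨resS (N * L ^ (j + 1)) κ, resS_mem_of_avgKernel hκ⟩‖ ^ 2 := by
  rw [norm_add_sq_real, horth _ hκ]
  nlinarith [sq_nonneg ‖gradOpK hWu (N * L ^ (j + 1)) ⟨resS (N * L ^ (j + 1)) κ, resS_mem_of_avgKernel hκ⟩‖]

end Carrier

end

end Summit.QuantumFields.BalabanUV.T4Continuum.NE7MinNormGaugeRepresentative
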